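import Mathlib
import Summits.Ventures.PercRepro2.TypedRow23Star
import Summits.Ventures.PercRepro2.TypedBasesStarRefutation

/-!
# (ROW-23*) is false: the kernel refutation of `Row23Star` on night-3 g19's 7-vertex witness
(blind cell PercRepro2, night-3 g20, 2026-08-28; `proofs/NIGHT3-CERT.md` §28.9 / §29)

g19's candidate (ROW-23*) (`CovForm.Row23Star`, `TypedRow23Star.lean`: every mixed `(2) − (3)`
difference of the typed base of `K₃` over a set of typed edges is nonnegative) was refuted by the
seat's own annealer the same night (§28.9). This file puts the refutation in the kernel on the
recorded witness: vertices `a₁ = 0, a₂ = 1, o = 2, b = 3, a₃ = 4, u₅ = 5, u₆ = 6`, edges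
`u₆–a₃ (1), u₆–u₅ (1), u₅–o (1), o–a₁ (2), u₆–a₂ (2), u₆–b (2)`, `z ≡ false`, `F` = all six
edges, `S = {g, h}` with `g = u₆–u₅`, `h = u₅–o`: the four typed bases with `(g, h)` of types
`(2,2), (3,2), (2,3), (3,3)` are `24, 16, 16, 0` (each a `decide +kernel` over the admissible
colourings through `typedClassCount_eq_sum_piFinset` and the bit kernel `K3z` of
`TypedBasesStarRefutation.lean`), so `mixedDiff … {g, h} = 24 − 16 − 16 + 0 = −8 < 0` and
**`not_row23Star_witness : ¬ Row23Star (R := ℚ) wEnds 2 0 1 4 3`**. The grid is g19's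
`[0 0 0 0; 0 4 8 4; 0 8 24 16; 0 4 16 0]` (tb.py, and this seat's tc.py). Own work; standard
axioms (no `native_decide`).
-/

namespace Summit.Ventures.PercRepro2

namespace CovForm

namespace Row23StarWitness

open TriOWitness

/-- The six edges as ordered pairs: `u₆–a₃, u₆–u₅, u₅–o, o–a₁, u₆–a₂, u₆–b`
(`a₁ = 0, a₂ = 1, o = 2, b = 3, a₃ = 4, u₅ = 5, u₆ = 6`). -/
def wPairs : Fin 6 → Fin 7 × Fin 7 :=
  ![(6, 4), (6, 5), (5, 2), (2, 0), (6, 1), (6, 3)]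

/-- The witness graph. -/
def wEnds : Fin 6 → Sym2 (Fin 7) := fun e => s((wPairs e).1, (wPairs e).2)

/-- `wEnds` is `wPairs`. -/
lemma wEnds_pairs : ∀ e, wEnds e = s((wPairs e).1, (wPairs e).2) := fun _ => rfl

/-- The types: `1` on the three path edges `u₆–a₃, u₆–u₅, u₅–o`, `2` on `o–a₁, u₆–a₂, u₆–b`. -/
def wτ : Fin 6 → ℕ := ![1, 1, 1, 2, 2, 2]

/-- The closed pinning. -/
def wZ : Config (Fin 6) := fun _ => false

/-- The pair of edges `S = {g, h} = {u₆–u₅, u₅–o}`. -/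
abbrev wS : Finset (Fin 6) := {1, 2}


/-! ## The bit table (64 configurations, 10 bits each) -/

/-- The index of a configuration: bit `e` is `ω e`. -/
def encode (ω : Config (Fin 6)) : ℕ :=
  (ω 0).toNat + 2 * (ω 1).toNat + 4 * (ω 2).toNat + 8 * (ω 3).toNat + 16 * (ω 4).toNat +
    32 * (ω 5).toNat

/-- The configuration of an index. -/
def ofNat (n : ℕ) : Config (Fin 6) := fun e => n.testBit e.val

/-- `ofNat` inverts `encode`. -/
lemma ofNat_encode : ∀ ω : Config (Fin 6), ofNat (encode ω) = ω := by decide +kernel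

/-- Indices are below `64`. -/
lemma encode_lt : ∀ ω : Config (Fin 6), encode ω < 64 := by decide +kernel

/-- The packed bit table: the word of configuration `n` (bit `e` of `n = ω e`) is
`(wT >>> (10 n)) &&& 1023`, its bit `k` the `k`-th field of `Bits` (`hl, lh, tl, th, lo, ho, lb,
hb, lt, ht`). Generated by the seat's own union-find (`mining/night-3/g20/mktable.py`), CHECKED by
the kernel in `bitsOf_ofNat`. -/
def wT : ℕ :=
    31537031630667032630011556246537400930308785671647797276798047858942996318781440 +
    99073076576207872665628154940723420951766543093568534385020377203973014394165505 * 10 ^ 80 +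
    455904524424401655645180771807541 * 10 ^ 160

/-- The bits of configuration `n`, read from the table. -/
def tableBits (n : ℕ) : Bits :=
  ⟨((wT >>> (10 * n)) &&& 1023).testBit 0, ((wT >>> (10 * n)) &&& 1023).testBit 1,
    ((wT >>> (10 * n)) &&& 1023).testBit 2, ((wT >>> (10 * n)) &&& 1023).testBit 3,
    ((wT >>> (10 * n)) &&& 1023).testBit 4, ((wT >>> (10 * n)) &&& 1023).testBit 5,
    ((wT >>> (10 * n)) &&& 1023).testBit 6, ((wT >>> (10 * n)) &&& 1023).testBit 7,
    ((wT >>> (10 * n)) &&& 1023).testBit 8, ((wT >>> (10 * n)) &&& 1023).testBit 9⟩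

/-- **The table is right**: for every index the computed bits (`bitsOf`, three `reachSet`s) are
the table's. -/
lemma bitsOf_ofNat : ∀ n : Fin 64, bitsOf wPairs (ofNat n) 2 0 1 4 3 = tableBits n := by
  decide +kernel

/-- The bits of any configuration are the table's at its index. -/
lemma bitsOf_eq_table (ω : Config (Fin 6)) : bitsOf wPairs ω 2 0 1 4 3 = tableBits (encode ω) := by
  have h := bitsOf_ofNat ⟨encode ω, encode_lt ω⟩
  simp only [ofNat_encode] at h
  exact h

/-- A typed base of `K₃` on the witness as an integer sum over the admissible colourings. -/
lemma count_eq_pi (τ : Fin 6 → ℕ) :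
    typedCount Finset.univ wZ τ (K3 (R := ℚ) wEnds 2 0 1 4 3) =
      ((∑ g ∈ Fintype.piFinset (edgeClass Finset.univ wZ τ ∅ wZ wZ wZ),
        K3z (tableBits (encode fun e => (g e).1)) (tableBits (encode fun e => (g e).2.1))
          (tableBits (encode fun e => (g e).2.2)) : ℤ) : ℚ) := by
  rw [← typedClassCount_empty Finset.univ wZ τ wZ wZ wZ, typedClassCount_eq_sum_piFinset]
  push_cast
  refine Finset.sum_congr rfl fun g _ => ?_
  rw [K3_eq_K3s wEnds_pairs, bitsOf_eq_table, bitsOf_eq_table, bitsOf_eq_table, cast_K3z]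

/-- `(g, h)` of types `(2, 2)`: the typed base is `24`. -/
lemma count_22 :
    typedCount Finset.univ wZ (mixedTypes wτ wS ∅) (K3 (R := ℚ) wEnds 2 0 1 4 3) = 24 := by
  rw [count_eq_pi]
  have h : (∑ g ∈ Fintype.piFinset (edgeClass Finset.univ wZ (mixedTypes wτ wS ∅) ∅ wZ wZ wZ),
      K3z (tableBits (encode fun e => (g e).1)) (tableBits (encode fun e => (g e).2.1))
        (tableBits (encode fun e => (g e).2.2))) = 24 := by
    decide +kernel
  rw [h]
  norm_num

/-- `(g, h)` of types `(3, 2)`: the typed base is `16`. -/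
lemma count_32 :
    typedCount Finset.univ wZ (mixedTypes wτ wS {1}) (K3 (R := ℚ) wEnds 2 0 1 4 3) = 16 := by
  rw [count_eq_pi]
  have h : (∑ g ∈ Fintype.piFinset (edgeClass Finset.univ wZ (mixedTypes wτ wS {1}) ∅ wZ wZ wZ),
      K3z (tableBits (encode fun e => (g e).1)) (tableBits (encode fun e => (g e).2.1))
        (tableBits (encode fun e => (g e).2.2))) = 16 := by
    decide +kernel
  rw [h]
  norm_num

/-- `(g, h)` of types `(2, 3)`: the typed base is `16`. -/
lemma count_23 :
    typedCount Finset.univ wZ (mixedTypes wτ wS {2}) (K3 (R := ℚ) wEnds 2 0 1 4 3) = 16 := by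
  rw [count_eq_pi]
  have h : (∑ g ∈ Fintype.piFinset (edgeClass Finset.univ wZ (mixedTypes wτ wS {2}) ∅ wZ wZ wZ),
      K3z (tableBits (encode fun e => (g e).1)) (tableBits (encode fun e => (g e).2.1))
        (tableBits (encode fun e => (g e).2.2))) = 16 := by
    decide +kernel
  rw [h]
  norm_num

/-- `(g, h)` of types `(3, 3)`: the typed base is `0` (the double contraction carries `o` into
`a₁`'s cluster). -/
lemma count_33 :
    typedCount Finset.univ wZ (mixedTypes wτ wS {1, 2}) (K3 (R := ℚ) wEnds 2 0 1 4 3) = 0 := by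
  rw [count_eq_pi]
  have h : (∑ g ∈ Fintype.piFinset (edgeClass Finset.univ wZ (mixedTypes wτ wS {1, 2}) ∅ wZ wZ wZ),
      K3z (tableBits (encode fun e => (g e).1)) (tableBits (encode fun e => (g e).2.1))
        (tableBits (encode fun e => (g e).2.2))) = 0 := by
    decide +kernel
  rw [h]
  norm_num

/-- The power set of `{g, h}`. -/
lemma powerset_wS : wS.powerset = {∅, {1}, {2}, {1, 2}} := by decide

/-- **The mixed difference over `{g, h}` on the witness is `−8`.** -/
lemma mixedDiff_witness :
    mixedDiff (R := ℚ) wEnds 2 0 1 4 3 Finset.univ wZ wτ wS = -8 := by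
  unfold mixedDiff
  rw [powerset_wS]
  rw [Finset.sum_insert (by decide), Finset.sum_insert (by decide), Finset.sum_insert (by decide),
    Finset.sum_singleton]
  rw [count_22, count_32, count_23, count_33]
  norm_num

/-- The types of the witness are in `{1, 2}`. -/
lemma wτ_mem : ∀ e ∈ (Finset.univ : Finset (Fin 6)), wτ e = 1 ∨ wτ e = 2 := by decide

/-- **(ROW-23*) is false**: on the witness the mixed `(2) − (3)` difference over the two path
edges `{u₆–u₅, u₅–o}` is `24 − 16 − 16 + 0 = −8 < 0`. -/
theorem not_row23Star_witness : ¬ Row23Star (R := ℚ) wEnds 2 0 1 4 3 := by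
  intro h
  have h1 := h Finset.univ wZ wτ wS (Finset.subset_univ _) wτ_mem
  rw [mixedDiff_witness] at h1
  norm_num at h1

end Row23StarWitness

end CovForm

end Summit.Ventures.PercRepro2
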